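import Literature.AlgebraicGeometry.Frobenioids.PadicFieldwiseSaturatedTemperedBase
import Literature.AnabelianGeometry.SemiGraphs.RelCosetCategories
import HarnessLib

/-!
# Frobenioids II, Theorem 2.4 (i), proof p. 20: «`Φ` fieldwise saturated ⟺ (a) ∧ (b)» over the printed base
# `D = B^temp(Π, Π°)⁰` BY NAME (`RelCosetCat Π°`)

Mochizuki, *The geometry of Frobenioids II*, Kyushu J. Math. **62** (2008) 401–460, §2 p. 17 [cite: MochizukiFrdII2008, §2 p.17]
("`D` is any category `B^temp(Π, Π°)⁰` as in Example 1.3, (iii) … `G_{ℚ_p} ⥲ Q`"), Example 1.3 (i) p. 11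
[cite: MochizukiFrdII2008, Ex 1.3 (i)(ii) p.11] ("`B^temp(Π, Π°) ⊆ B^temp(Π)` for the full subcategory of objects that admit
a morphism to the object `Π/Π°`"), Theorem 2.4 (i) proof p. 20 ll. 9–22 [cite: MochizukiFrdII2008, Thm 2.4 (i) p.20].

PROOF-ONLY file (abc-iut cell, seat abc-iut-w5-d229; SUBDAG-FrdII-Thm24 row **W12-L01b**, GAP-LEDGER **G-w5d229-1**; no
definitions): the instance, BY NAME, of `PadicFieldwiseSaturatedTemperedBase.lean` (stated over an arbitrary domination-closed
object property `P` of `CosetCat Π`) at abc-iut-L1-t4's small model of the printed base,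
`RelCosetCat Π° = (CosetCat.admitsHomTo Π°).FullSubcategory` (`RelCosetCategories.lean`: "objects that admit a morphism to
`Π/Π°`", domination-closed by `CosetCat.admitsHomTo_of_hom`), with base functor
`RelCosetCat.incl Π° ⋙ CosetCat.push φ _ ⋙ CosetCat.toConnected _ ⋙ QuasiTemperoid.galoisPadicFields p`
(= `RelCosetCat.incl Π° ⋙ CosetCat.push φ _ ⋙ PadicFrd.baseZero p` definitionally). Classical; nothing here bears on
[IUTchIII] Cor. 3.12; no statement of the paper is strengthened.
-/

noncomputable section

open CategoryTheory Opposite Function Topology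
open Literature.AnabelianGeometry.SemiGraphs

namespace Literature.AlgebraicGeometry.Frobenioids

namespace PadicFrd

namespace Datum

open QuasiTemperoid

variable (p : ℕ) [Fact p.Prime] {Γ : Type} [Group Γ] [TopologicalSpace Γ]
  (φ : Γ →* GalFbar ℚ_[p]) (hφ : Continuous φ) (ho : IsOpenMap φ) (hΓ : IsTempered Γ)

include hφ hΓ in
/-- **The printed base BY NAME**: `D = B^temp(Π, Π°)⁰` is abc-iut-L1-t4's `RelCosetCat Π°`
(`= (CosetCat.admitsHomTo Π°).FullSubcategory`, "objects that admit a morphism to `Π/Π°`", domination-closed by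
`CosetCat.admitsHomTo_of_hom`), and the base functor `D → D₀` is `RelCosetCat.incl Π° ⋙ CosetCat.push φ _ ⋙ (D₀ → fields)`
(`PadicFrd.baseZero p = CosetCat.toConnected _ ⋙ galoisPadicFields p` definitionally). For every `p`-adic Frobenioid datum
over it: «`Φ` fieldwise saturated ⟺ (a) ∧ (b)», no binders. [cite: MochizukiFrdII2008, Thm 2.4 (i) p.20] -/
theorem isFieldwiseSaturated_iff_divisible_and_descent_relCosetBase (H : OpenSubgroup Γ) (d : Datum (RelCosetCat H) p)
    (hd : d.base = RelCosetCat.incl H ⋙ CosetCat.push φ ho ⋙ CosetCat.toConnected (isTempered_galFbar ℚ_[p]) ⋙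
      galoisPadicFields p) :
    d.IsFieldwiseSaturated ↔
      (∀ (C : RelCosetCat H) (x : d.Φ.obj (op C)) (n : ℕ), 0 < n →
          ∃ (B : RelCosetCat H) (f : B ⟶ C) (y : d.Φ.obj (op B)), y ^ n = (d.Φ.map f.op).hom x) ∧
        (∀ ⦃B C : RelCosetCat H⦄ (f : B ⟶ C), B.obj.sg.toSubgroup.Normal → ∀ b : d.B.obj (op B),
          (∃ y : d.Φ.obj (op B), Frobenioids.divB d.Φ d.B d.divB (op B) b = Algebra.GrothendieckGroup.of y) →
          (∀ σ : B ⟶ B, σ ≫ f = f → (d.B.map σ.op).hom b = b) →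
          ∃ c : d.B.obj (op C),
            (∃ z : d.Φ.obj (op C), Frobenioids.divB d.Φ d.B d.divB (op C) c = Algebra.GrothendieckGroup.of z) ∧
            (d.B.map f.op).hom c = b) :=
  isFieldwiseSaturated_iff_divisible_and_descent_temperedBase p φ hφ ho hΓ (CosetCat.admitsHomTo H)
    (fun f h => CosetCat.admitsHomTo_of_hom H f h) d hd


include hφ hΓ in
/-- The forward direction over `B^temp(Π, Π°)⁰ = RelCosetCat Π°` ([FrdII] Thm. 2.4 (ii), p. 20 l. −5: "`Φᵢ` fieldwise saturated
⇒ …"): (a) and (b) hold. [cite: MochizukiFrdII2008, Thm 2.4 (i) p.20] -/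
theorem divisible_and_descent_of_isFieldwiseSaturated_relCosetBase (H : OpenSubgroup Γ) (d : Datum (RelCosetCat H) p)
    (hd : d.base = RelCosetCat.incl H ⋙ CosetCat.push φ ho ⋙ CosetCat.toConnected (isTempered_galFbar ℚ_[p]) ⋙
      galoisPadicFields p) (hfs : d.IsFieldwiseSaturated) :
    (∀ (C : RelCosetCat H) (x : d.Φ.obj (op C)) (n : ℕ), 0 < n →
        ∃ (B : RelCosetCat H) (f : B ⟶ C) (y : d.Φ.obj (op B)), y ^ n = (d.Φ.map f.op).hom x) ∧
      (∀ ⦃B C : RelCosetCat H⦄ (f : B ⟶ C), B.obj.sg.toSubgroup.Normal → ∀ b : d.B.obj (op B),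
        (∃ y : d.Φ.obj (op B), Frobenioids.divB d.Φ d.B d.divB (op B) b = Algebra.GrothendieckGroup.of y) →
        (∀ σ : B ⟶ B, σ ≫ f = f → (d.B.map σ.op).hom b = b) →
        ∃ c : d.B.obj (op C),
          (∃ z : d.Φ.obj (op C), Frobenioids.divB d.Φ d.B d.divB (op C) c = Algebra.GrothendieckGroup.of z) ∧
          (d.B.map f.op).hom c = b) :=
  (isFieldwiseSaturated_iff_divisible_and_descent_relCosetBase p φ hφ ho hΓ H d hd).mp hfs

/-! ### Non-vacuity: `C₀` restricted to `B^temp(Π, Π°)⁰` is such a datum, and (a), (b) hold for it -/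

/-- Every value of the base `B^temp(Π, Π°)⁰ → D₀` is a `p`-adic local field (hypothesis `isPadicLocal` of `PadicFrd.Datum`).
[cite: MochizukiFrdII2008, Ex 1.3 (iii) pp.11-12] -/
theorem isPadicLocal_relCosetBase (H : OpenSubgroup Γ) (A : RelCosetCat H) :
    ((RelCosetCat.incl H ⋙ CosetCat.push φ ho ⋙ CosetCat.toConnected (isTempered_galFbar ℚ_[p]) ⋙
      galoisPadicFields p).obj A).IsPadicLocal :=
  isPadicLocal_galoisPadicFields p _

/-- … hence `ord(O_K^⊳)` is monoprime at every value (hypothesis `hmono` of `PadicFrd.Datum.zero`).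
[cite: MochizukiFrdII2008, Ex 1.1 (i)(ii) pp.7-8] -/
theorem isMonoprime_ordInt_relCosetBase (H : OpenSubgroup Γ) (A : RelCosetCat H) :
    IsMonoprime (OrdInt ((RelCosetCat.incl H ⋙ CosetCat.push φ ho ⋙ CosetCat.toConnected (isTempered_galFbar ℚ_[p]) ⋙
      galoisPadicFields p).obj A).K) := by
  obtain ⟨alg, hfin, hc⟩ := (isPadicLocal_relCosetBase p φ ho H A).exists_finite
  letI := alg
  haveI := hfin
  exact PadicFld.isMonoprime_ordInt _ hc

include hφ hΓ in
/-- **The equivalence fires over the printed base**: the `p`-adic Frobenioid `C₀|_{B^temp(Π, Π°)⁰}` of Ex. 1.1 (i)/(ii)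
(`Φ := Φ₀`, `B := B₀`; a datum by `PadicFrd.Datum.zero` over the connected, totally epimorphic `RelCosetCat Π°`) is
fieldwise saturated, hence (a) and (b) HOLD for it — in particular Galois descent of effective elements of `B₀ = K^×` along
every `Π/U → Π/V`, `U ⊴ Π` (kernel instance, no hypotheses beyond the §2 setting). [cite: MochizukiFrdII2008, Thm 2.4 (i) p.20] -/
theorem divisible_and_descent_zero_relCosetBase (H : OpenSubgroup Γ) :
    let d := Datum.zero (RelCosetCat.incl H ⋙ CosetCat.push φ ho ⋙ CosetCat.toConnected (isTempered_galFbar ℚ_[p]) ⋙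
        galoisPadicFields p) (isPadicLocal_relCosetBase p φ ho H) (RelCosetCat.isConnected H)
      (RelCosetCat.isTotallyEpimorphic H) (isMonoprime_ordInt_relCosetBase p φ ho H)
    (∀ (C : RelCosetCat H) (x : d.Φ.obj (op C)) (n : ℕ), 0 < n →
        ∃ (B : RelCosetCat H) (f : B ⟶ C) (y : d.Φ.obj (op B)), y ^ n = (d.Φ.map f.op).hom x) ∧
      (∀ ⦃B C : RelCosetCat H⦄ (f : B ⟶ C), B.obj.sg.toSubgroup.Normal → ∀ b : d.B.obj (op B),
        (∃ y : d.Φ.obj (op B), Frobenioids.divB d.Φ d.B d.divB (op B) b = Algebra.GrothendieckGroup.of y) →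
        (∀ σ : B ⟶ B, σ ≫ f = f → (d.B.map σ.op).hom b = b) →
        ∃ c : d.B.obj (op C),
          (∃ z : d.Φ.obj (op C), Frobenioids.divB d.Φ d.B d.divB (op C) c = Algebra.GrothendieckGroup.of z) ∧
          (d.B.map f.op).hom c = b) :=
  divisible_and_descent_of_isFieldwiseSaturated_relCosetBase p φ hφ ho hΓ H _ rfl (isFieldwiseSaturated_zero _ _ _ _ _)

end Datum

end PadicFrd

end Literature.AlgebraicGeometry.Frobenioids

end
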